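import Summits.HodgeConjecture.CorCM.B01.Transposition.HComp.PiecesOfRecordDetectingLine
import Summits.HodgeConjecture.CorCM.B01.Transposition.HComp.HeckeTranslatesOfSec42DataOf
import Summits.HodgeConjecture.HodgeConjecture.Theorems.HLiu418SeesawDetectionAlbaneseCmp
import Summits.HodgeConjecture.CorCM.B01.Transposition.HComp.BaseChangeComp
import Literature.NumberTheory.Automorphic.Liu2021.AppendixC.TowerMorphismSeesawDetection
import Literature.AlgebraicGeometry.ShimuraVarieties.UnitaryShimuraIdentityPieceReductionTotal
import Literature.AlgebraicGeometry.ShimuraVarieties.UnitaryAnisotropicLineFrame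
import Literature.AlgebraicGeometry.Motives.BaseChangeAlgebraicExtension
import HarnessLib

/-!
# Line `a3_liu418`, residual `stub_S34`, clause (1) of `S34SomeSource` — the TARGET SIDE at the explicit §4.2 carrier

Cell `hodgecm-mathlib` (D-0151), fan A, crux `HLiu418` (stmt-HodgeConjecture-24832), registered residual `stub_S34 : S34AtFace` (registry
`Cruxes/HLiu418/Lines/a3_liu418.lean` v17); GS programme node (7-main), TARGET half (KEY `A-plan/keys/KEY-hodgecm-mathlib-A-gs7-clause1-lead.draft.md`).
THEOREMS ONLY: no definition, no instance, no named fact, no `sorry`.  HC_CM is NOT proved by this file (proved only modulo the 7 printed citations).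

Print ([Liu2021] proof of Thm. 4.15, p. 51, FJcycle.tex l. 2199–2213 with fn. 9): «for every class `c ∈ H¹_{(2)}(Sh(G,h), ℂ)`, using the same proof
of [MR92, Proposition 6], one can find a decomposition `V = V⋆ ⊕ V⋆^⊥` … such that the image of `c` under the restriction map … is nonzero».  For the
tree's seesaw input `S34SomeSource C U ℓ X ι′ μ hμ T Pin` (clause (1): `((s.M.toEtaleTowerHom.etPull ℓ).baseChange ℚ_ℓ^{ac}).comp f ≠ 0`) everything
that does NOT mention the source is assembled here at the EXPLICIT carrier `C₄ := Model.sec42DataOfFourLe h V Φ h4 iso` (`X_K = M_K ⊗_{F,c} F`;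
`Model.sec42DataOf … = C₄` only propositionally, `sec42DataOf_eq_of_four_le`) with translates `T₄ := sec42DataOfFourLe_heckeTranslates hU7 h V Φ h4 iso`
and `τ′ := conj ∘ ι₁`, so that `(X_K)_{τ′} ≅ (M_K)_{ι₁}` (the bridge `E_K`, an explicit TERM: transitivity of base change along `τ′ ∘ c = ι₁`,
[GortzWedhorn2020] Prop. 4.16, and `recordFunctorOf_objIso`):
* §1 `E_K` is natural for the Hecke translates; `albaneseH1Cmp` ([Liu2021] Lem. 2.4 (1)) is natural along `Alb(T_g)` and INJECTIVE at every level
  of `C₄` (E-pinned pieces ★ `HComp.RecordSystem.exists_pieces_fieldRange` are compact ball quotients; ★ A-p02 `injective_albaneseH1Cmp_of_cofan_ballDatum`);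
* §2 the record detour (★ (7d-total) `RecordSystem.exists_heckeTranslateIso_identityPiece_ne_zero`) and the HEAD
  `exists_identityPiece_detectingFrame_of_omegaHom_ne_zero`: for `f ≠ 0` in the Hom-space, a conjugate level `Λ`, a level class `y′`, the E-pinned
  pieces of `(M_Λ)_{ι₁}`, a `2 + 1` frame `(J⋆, J⊥, B₀)` of `V.Hm`, and the class `c₁` cut out by `cmp_Λ y′` on the IDENTITY piece such that (i) III-8′
  (named fact `MR92Prop6Source`, binder `hMR`, through ★ (7c-rec) and the frame engine) detects `c₁` by every special curve satisfying the four
  `F`-clauses — verbatim the `hdet` binder of ★ (7-src) `UnitaryCanonicalModel.exists_fac_pullback_ne_zero_of_rational_reps` — and (ii) every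
  morphism of towers `M` whose level-`Λ` map detects `cmp_Λ y′` satisfies clause (1) (★ spine `bettiPinning_exists_scheme_class_detecting_hecke_albaneseH1Cmp`).
The SOURCE half (GS-3/4/5b/8-core, ★ (7-src)) consumes exactly this export; transport to the total carrier `CV` is ONE `subst` at the end of the closer.
Edition 2 (proof bodies only; every statement and docstring byte-identical to ★ p680277): §2a at Lean's default budget, §2b at `maxHeartbeats 400000`
(were 800 000 / 8 000 000; measured 48 k / 211 k; farm wall 313 s → 32 s) — two kernel/elaborator hygiene rules recorded at the proof steps they cure.

References: [Liu2021] Y. Liu, Camb. J. Math. 9 (2021) = arXiv:2102.11518, Thm. 4.15 proof (l. 2185–2213, fn. 9), §4.2–§4.3, Lem. 2.4 (1), App. C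
l. 4656; [MurtyRamakrishnan1992] Prop. 6 (through [Liu2021] fn. 9; not held); [Milne2005ShimuraVarieties] Thm. 13.6, §5; [Deligne1979ShimuraVarieties]
2.1.2–2.1.4, 2.2.5; [GortzWedhorn2020] Prop. 4.16; [Arapura2012] Cor. 15.4.6; [SGA4Tome3] XI 4.4.
-/

set_option autoImplicit false

noncomputable section

open scoped Matrix ComplexOrder TensorProduct
open Set Function MulAction Matrix NumberField CategoryTheory CategoryTheory.Limits AlgebraicGeometry Opposite
open Literature.Geometry.ComplexHyperbolic
open Literature.Geometry.ComplexHyperbolic.BallModel (U21 Ball proj lift mat x₀)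
open Literature.NumberTheory.Automorphic
open Literature.NumberTheory.Automorphic.UnitaryGroup
open Literature.NumberTheory.Automorphic.ShimuraDissection (CosetSpace)
open Literature.AlgebraicGeometry.ShimuraVarieties (negCone UnitaryBallUniformisationDatum IsCongruenceSubgroup IsTotallyPositive)
open Literature.AlgebraicGeometry.ShimuraVarieties.UnitaryCanonicalModel (Record RecordSystem heckeTranslate_definedOver exists_recordSystem)
open Literature.AlgebraicGeometry.Motives (SchemeOver ComplexPoints AlgPoints IsSmoothProjective IsProjectiveOver baseChangeHom
  baseChangeHomObjIsoOfComp)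
open Literature.AlgebraicGeometry.Motives.AbelianVariety (bcFunctor rationalTateModuleMap)
open Literature.AlgebraicGeometry.HodgeTheory (complexBetti)
open Literature.AlgebraicTopology.SingularHomology (singularCohomology)
open Literature.NumberTheory.Automorphic.Liu2021.AppendixC
open Summit.HodgeConjecture.CorCM.HComp
open Summit.HodgeConjecture.CorCM.D2Bridge (AlbanesePieces albaneseH1Cmp albaneseH1Cmp_natural complexBetti_eq_zero_of_forall_map_inj
  injective_albaneseH1Cmp_of_cofan_ballDatum bettiPinning_exists_scheme_class_detecting_hecke_albaneseH1Cmp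
  bettiPinning_exists_scheme_class_detecting_hecke_albaneseH1Cmp_of_n_eq_two)

/-! ## §1a  Albanese-comparison naturality along a Hecke translate (any §4.2 datum) -/
namespace Literature.NumberTheory.Automorphic.Liu2021.AppendixC

variable {F E : Type} [Field F] [NumberField F] [IsTotallyReal F] [Field E] [NumberField E] [Algebra F E]
  [IsTotallyComplex E] [Algebra.IsQuadraticExtension F E]
variable {P5 : PropC5Data F E} {iso : ℕ → Prop} {C : Sec42Data P5 iso}

/-- **`cmp` is natural along `Alb(T_g)`**: `cmp_K (Alb(T_g)^* y) = (T_g ×_{τ′} ℂ)^* (cmp_{K′} y)` for `cmp := albaneseH1Cmp` — ★ `albaneseH1Cmp_natural`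
at the α-compatible pair `(T_g, ∇T_g, Alb(T_g))` (★ `Nabla.map_incl`, ★ `α_albTr`). [cite: Liu2021, Def. 2.3 (FJcycle.tex l. 1206–1208) and §4.2 l. 2070–2074] -/
theorem Sec42Data.HeckeTranslates.albaneseH1Cmp_bettiPullAlong_albTr (T : C.HeckeTranslates) (τ' : E →+* ℂ) (g : C.G)
    (K K' : C5.SmallLevel C.S.K₀) (hK : C5.HeckeLE g K K') (y : C.bettiH1 τ' K') :
    letI : Algebra E ℂ := algebraAlong E τ'
    albaneseH1Cmp (C.X K) (C.alb K) (bettiPullAlong τ' (T.albTr g K K' hK) y) =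
      schemeBettiPullAlong τ' (T.tr g K K' hK) (albaneseH1Cmp (C.X K') (C.alb K') y) := by
  letI : Algebra E ℂ := algebraAlong E τ'
  exact albaneseH1Cmp_natural (C.alb K) (C.alb K') _ _ (C.cpt.smooth_X K) (C.cpt.projective_X K) (C.cpt.smooth_X K')
    (C.cpt.projective_X K') (T.tr g K K' hK) _ (T.albTr g K K' hK) ((C.alb K).nabla.map_incl (C.alb K').nabla (T.tr g K K' hK))
    (T.α_albTr g K K' hK) y

end Literature.NumberTheory.Automorphic.Liu2021.AppendixC

namespace Summit.HodgeConjecture.CorCM.Model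

/-! ## §1b  The bridge `E_K : (X_K)_{τ′} ≅ (M_K)_{ι₁}` at the explicit carrier and its naturality for the Hecke translates -/
section Bridge
variable {F : CMField} {ι₁ : F →+* ℂ}

/-- `(conj ∘ ι₁) ∘ c = ι₁` for the CM conjugation `c` of `F` (`ι₁ (c x) = conj (ι₁ x)`, Mathlib `IsCMField.complexEmbedding_complexConj`).
[cite: Liu2021, App. C Rem. C.2 (FJcycle.tex l. 4583–4596)] -/
theorem conj_comp_comp_cmConjRingHom (ι₁ : F →+* ℂ) : ((starRingEnd ℂ).comp ι₁).comp (cmConjRingHom F) = ι₁ := by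
  ext x
  rw [RingHom.coe_comp, RingHom.coe_comp, Function.comp_apply, Function.comp_apply, embedding_cmConjRingHom, starRingEnd_self_apply]

variable (V : HermSpace3 F ι₁) (h4 : 4 ≤ Module.finrank ℚ F)

/-- **The bridge `E_K := (base change along (conj ∘ ι₁) ∘ c = ι₁) ≪≫ (recordFunctorOf_objIso)_{ι₁} : (X_K)_{τ′} ≅ (M_K)_{ι₁}` is natural for the Hecke
translates**: `(T_g)_{τ′} ≫ E_{K′} = E_K ≫ (T_g^{rec})_{ι₁}`, the explicit carrier's `T_g` in its `rfl`-unfolded form `(recordFunctorHeckeTranslate g)^{(c)}`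
(`sec42DataOfFourLe_heckeTranslates_tr`), `T_g^{rec} = recordHeckeTranslate …` ([Milne2005ShimuraVarieties] Thm. 13.6). [cite: GortzWedhorn2020, Prop. 4.16 and §(4.7)]
[cite: Milne2005ShimuraVarieties, Thm. 13.6 p. 118 L21–28] [cite: Liu2021, App. C l. 4656 and Prop. C.5 l. 4627–4633] -/
theorem baseChange_recordFunctorHeckeTranslate_comp_bridge_hom (hU7 : heckeTranslate_definedOver) (h : exists_recordSystem)
    (g : ↥V.adelicFin) (K K' : C5.SmallLevel (K3 V))
    (hK : C5.HeckeLE g K K') :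
    (baseChangeHom ((starRingEnd ℂ).comp ι₁)).map
          ((baseChangeHom (cmConjRingHom F)).map (recordFunctorHeckeTranslate hU7 h V h4 g K K' hK)) ≫
        (baseChangeHomObjIsoOfComp (cmConjRingHom F) ((starRingEnd ℂ).comp ι₁) ι₁ (conj_comp_comp_cmConjRingHom ι₁)
            ((recordFunctorOf h V).obj K') ≪≫
          (baseChangeHom ι₁).mapIso (recordFunctorOf_objIso h V h4 K')).hom =
      (baseChangeHomObjIsoOfComp (cmConjRingHom F) ((starRingEnd ℂ).comp ι₁) ι₁ (conj_comp_comp_cmConjRingHom ι₁)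
            ((recordFunctorOf h V).obj K) ≪≫
          (baseChangeHom ι₁).mapIso (recordFunctorOf_objIso h V h4 K)).hom ≫
        (baseChangeHom ι₁).map (recordHeckeTranslate hU7 h V h4 g K K' hK) := by
  -- the record-level square `T_g^{RF} ≫ objIso_{K′} = objIso_K ≫ T_g^{rec}` (definition of `recordFunctorHeckeTranslate`)
  have hsq : recordFunctorHeckeTranslate hU7 h V h4 g K K' hK ≫ (recordFunctorOf_objIso h V h4 K').hom =
      (recordFunctorOf_objIso h V h4 K).hom ≫ recordHeckeTranslate hU7 h V h4 g K K' hK := by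
    simp only [recordFunctorHeckeTranslate, Category.assoc, Iso.inv_hom_id, Category.comp_id]
  rw [Iso.trans_hom, Iso.trans_hom, Functor.mapIso_hom, Functor.mapIso_hom,
    Literature.AlgebraicGeometry.Motives.baseChangeHomObjIsoOfComp_comm_assoc, ← Functor.map_comp, hsq, Functor.map_comp,
    Category.assoc]

end Bridge
/-! ## §1c  Injectivity of the Albanese comparison at the explicit carrier's levels (Lemma 2.4 (1) on compact ball quotients) -/
section Injective
variable {F : CMField} {ι₁ : F →+* ℂ}
variable (V : HermSpace3 F ι₁) (Φ : Literature.AlgebraicGeometry.Motives.CMType F) (h4 : 4 ≤ Module.finrank ℚ F) (iso : ℕ → Prop)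

/-- **`cmp_K` is injective at every level of `C₄`** along `τ′ = conj ∘ ι₁`: `(X_K)_{τ′} ≅ (M_K)_{ι₁}` (bridge `E_K`) is the coproduct of the E-pinned pieces
(★ `HComp.RecordSystem.exists_pieces_fieldRange`, compact ball quotients; legs transported along `E_K⁻¹` by ★ BC5), so [Liu2021] Lem. 2.4 (1) holds
unconditionally (★ `injective_albaneseH1Cmp_of_cofan_ballDatum`, [Arapura2012] Cor. 15.4.6).
[cite: Liu2021, Lemma 2.4 (1) (FJcycle.tex l. 1210–1213) with proof (l. 1220–1228)] [cite: Arapura2012, Cor. 15.4.6] [cite: Deligne1979ShimuraVarieties, 2.1.2] -/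
theorem injective_albaneseH1Cmp_fourLe (h : exists_recordSystem) (K : C5.SmallLevel (sec42DataOfFourLe h V Φ h4 iso).S.K₀) :
    letI : Algebra F ℂ := Literature.NumberTheory.Automorphic.Liu2021.AppendixC.algebraAlong F ((starRingEnd ℂ).comp ι₁)
    Injective (albaneseH1Cmp ((sec42DataOfFourLe h V Φ h4 iso).X K) ((sec42DataOfFourLe h V Φ h4 iso).alb K)) := by
  letI : Algebra F ℂ := Literature.NumberTheory.Automorphic.Liu2021.AppendixC.algebraAlong F ((starRingEnd ℂ).comp ι₁)
  -- the E-pinned pieces of `(M_K)_{ι₁}`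
  obtain ⟨g, hg, X, ι, hcol, B, hB⟩ := Summit.HodgeConjecture.CorCM.HComp.RecordSystem.exists_pieces_fieldRange _ V.Hm ι₁
    (Model.frameOf V) (Model.formCongr_frameOf V) V.isHermitian (HermSpace3.anisotropic_of_four_le V h4) V.posDef_of_ne
    (torsionFree_arithmeticLevel_conj_K3 V) (Model.recordOf h V h4) K
  haveI : Finite (orbitRel.Quotient (rational (↥(maximalRealSubfield F)) F (IsCMField.complexConj F) 3 V.Hm)
      (CosetSpace (rationalToFinAdelic (↥(maximalRealSubfield F)) F (IsCMField.complexConj F) 3 V.Hm) K.1.1)) :=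
    UnitaryGroup.finite_shimuraIndex (hanis := HermSpace3.anisotropic_of_four_le V h4) (K := K.1.1) (hK := K.1.2.1)
  -- transported along `E_K⁻¹` they are pieces of `(X_K)_{τ′}` (★ BC5: generic cofan transport — no kernel unfolding of the face terms)
  let E : (bcFunctor F ℂ).obj ((sec42DataOfFourLe h V Φ h4 iso).X K) ≅ (baseChangeHom ι₁).obj ((recordOf h V h4).M.obj K) :=
    baseChangeHomObjIsoOfComp (cmConjRingHom F) ((starRingEnd ℂ).comp ι₁) ι₁ (conj_comp_comp_cmConjRingHom ι₁)
        ((recordFunctorOf h V).obj K) ≪≫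
      (baseChangeHom ι₁).mapIso (recordFunctorOf_objIso h V h4 K)
  obtain ⟨hcol'⟩ := nonempty_isColimit_cofanMk_comp_inv ι ⟨hcol⟩ E
  haveI := (sec42DataOfFourLe h V Φ h4 iso).cpt.smooth_X K
  exact injective_albaneseH1Cmp_of_cofan_ballDatum ((sec42DataOfFourLe h V Φ h4 iso).alb K) (d := (honestP5Of h F ι₁ V Φ).n - 1)
    ((sec42DataOfFourLe h V Φ h4 iso).cpt.projective_X K) X (fun q => ι q ≫ E.inv) hcol' B

end Injective
/-! ## §2a  The record detour at one level: from a class non-zero on `(M_{K″})_{ι₁}` to the identity piece of a conjugate level -/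
section Detour
variable {F : CMField} {ι₁ : F →+* ℂ}
variable (V : HermSpace3 F ι₁) (h4 : 4 ≤ Module.finrank ℚ F)

/-- **The (7d) detour at the chosen record system `Model.recordOf h V h4`.**  For `K″` normalised by `K′` with class representatives `g′_q` of `Ξ_{K′}`,
`g′_q K″ g′_q⁻¹ ⊆ K_f(3)` (the ★ (L4) shrink), and `x ∈ Hⁿ((M_{K″})_{ι₁}(ℂ); ℂ)` NON-ZERO: presenting `(M_{K″})_{ι₁}` by its E-pinned pieces (★ 7a), detecting `x`
on one of them (★ `complexBetti_eq_zero_of_forall_map_inj`) and applying ★ (7d-total) (translates from the named fact `hU7`, [Milne2005ShimuraVarieties] Thm.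
13.6) gives `b` with `bK″b⁻¹ ⊆ K_f(3)` and an isomorphism of levels `e : M_Λ ≅ M_{K″}`, `Λ = bK″b⁻¹ ∩ K_f(3)` (`e.hom` a `b`-, `e.inv` a `b⁻¹`-translate), with
`(e.hom)_{ι₁}^* x` non-zero on every leg through the IDENTITY class of every pieces presentation of `(M_Λ)_{ι₁}`.
[cite: Milne2005ShimuraVarieties, Thm. 13.6 p. 118 L21–28; §5 p. 58 L6–11; Lemma 5.13 p. 57] [cite: Deligne1979ShimuraVarieties, 2.1.2–2.1.4 and 2.2.5] -/
theorem exists_heckeTranslateIso_identityPiece_ne_zero_recordOf (hU7 : heckeTranslate_definedOver) (h : exists_recordSystem)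
    {K' K'' : C5.SmallLevel (K3 V)}
    (hnorm : ∀ k ∈ K'.1.1, ∀ n ∈ K''.1.1, k⁻¹ * n * k ∈ K''.1.1)
    (g' : orbitRel.Quotient (rational (↥(maximalRealSubfield F)) F (IsCMField.complexConj F) 3 V.Hm)
          (CosetSpace (rationalToFinAdelic (↥(maximalRealSubfield F)) F (IsCMField.complexConj F) 3 V.Hm) K'.1.1) → ↥V.adelicFin)
    (hg' : ∀ q, Quotient.mk'' (CosetSpace.pt (rationalToFinAdelic _ F _ 3 V.Hm) K'.1.1 (g' q)) = q)
    (hg0 : ∀ q, ∀ n ∈ K''.1.1, g' q * n * (g' q)⁻¹ ∈ (K3 V).1)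
    (n : ℕ) {x : complexBetti ((baseChangeHom ι₁).obj ((recordOf h V h4).M.obj K'')) n} (hx : x ≠ 0) :
    ∃ (b : ↥V.adelicFin) (_ : ∀ y ∈ K''.1.1, b * y * b⁻¹ ∈ (K3 V).1)
      (e : (recordOf h V h4).M.obj (C5.heckeLevel b K'') ≅ (recordOf h V h4).M.obj K''),
      (recordOf h V h4).IsHeckeTranslate (C5.heckeLevel b K'') K'' b e.hom ∧
      (recordOf h V h4).IsHeckeTranslate K'' (C5.heckeLevel b K'') b⁻¹ e.inv ∧
      ∀ {Ξ : Type} {Y : Ξ → SchemeOver ℂ} {ι : ∀ q, Y q ⟶ (baseChangeHom ι₁).obj ((recordOf h V h4).M.obj (C5.heckeLevel b K''))}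
        (D : ∀ q, UnitaryBallUniformisationDatum 2 (Y q))
        (_ : IsColimit (Cofan.mk ((baseChangeHom ι₁).obj ((recordOf h V h4).M.obj (C5.heckeLevel b K''))) ι))
        (q₁ : Ξ) (_ : (D q₁).Hℂ = V.Hm.map ι₁) (a : ↥V.adelicFin)
        (_ : (Quotient.mk'' (CosetSpace.pt (rationalToFinAdelic _ F _ 3 V.Hm) (C5.heckeLevel b K'').1.1 a) :
            orbitRel.Quotient (rational (↥(maximalRealSubfield F)) F (IsCMField.complexConj F) 3 V.Hm)
              (CosetSpace (rationalToFinAdelic (↥(maximalRealSubfield F)) F (IsCMField.complexConj F) 3 V.Hm) (C5.heckeLevel b K'').1.1)) =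
          Quotient.mk'' (CosetSpace.pt (rationalToFinAdelic _ F _ 3 V.Hm) (C5.heckeLevel b K'').1.1 1))
        (_ : letI : Algebra F ℂ := ι₁.toAlgebra
          ∀ z : Ball, AlgPoints.map (L := ℂ) (ι q₁) ((D q₁).unif ((Model.frameOf V : Matrix (Fin 3) (Fin 3) ℂ) *ᵥ BallModel.lift z)) =
            AlgPoints.baseChangeEquiv ι₁ ((recordOf h V h4).M.obj (C5.heckeLevel b K''))
              (((recordOf h V h4).pts (C5.heckeLevel b K'')).symm
                (ShimuraSet.mk F V.Hm ι₁ (Model.frameOf V) (Model.formCongr_frameOf V) (C5.heckeLevel b K'').1.1 z a))),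
        (complexBetti.map (ι q₁) n).hom ((complexBetti.map ((baseChangeHom ι₁).map e.hom) n).hom x) ≠ 0 := by
  -- Hecke translates of the chosen record system, from the named fact (U7)
  have hS : (recordOf h V h4).HeckeTranslateDefinedOver := hU7 F V.Hm ι₁ (Model.frameOf V) (Model.formCongr_frameOf V) V.posDef_of_ne
    (HermSpace3.anisotropic_of_four_le V h4) (K3 V) (torsionFree_arithmeticLevel_conj_K3 V) (recordOf h V h4)
  -- the E-pinned pieces of `(M_{K″})_{ι₁}` (ed. 2: `∃`-facts are BOUND before `obtain` — on an application `rcases` generalises it over the goal, ≈ 80–158 k heartbeats a site)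
  have h7a := Summit.HodgeConjecture.CorCM.HComp.RecordSystem.exists_pieces_fieldRange _ V.Hm ι₁ (Model.frameOf V) (Model.formCongr_frameOf V) V.isHermitian
    (HermSpace3.anisotropic_of_four_le V h4) V.posDef_of_ne (torsionFree_arithmeticLevel_conj_K3 V) (Model.recordOf h V h4) K''
  obtain ⟨g'', -, X'', ι'', hcol'', B'', hB''⟩ := h7a
  -- `x` is non-zero on SOME piece
  have hq : ∃ q, (complexBetti.map (ι'' q) n).hom x ≠ 0 := by
    by_contra hall
    push Not at hall
    exact hx (complexBetti_eq_zero_of_forall_map_inj hcol'' hall)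
  obtain ⟨q'', hq''⟩ := hq
  -- (7d-total)
  have h7d := (recordOf h V h4).exists_heckeTranslateIso_identityPiece_ne_zero hS hnorm g' hg' hg0 B'' hcol'' g'' (fun q => (hB'' q).2.1)
    (fun q z => (hB'' q).2.2.2 z) n q'' hq''
  obtain ⟨b, hb, e, he, he', hId⟩ := h7d
  exact ⟨b, hb, e, he, he', fun D hcol q₁ hD a ha hι => hId D hcol q₁ hD a ha hι⟩

end Detour
/-! ## §2b  THE TARGET SIDE OF CLAUSE (1) at the explicit carrier -/
section Main
variable {F : CMField} {ι₁ : F →+* ℂ}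

set_option maxHeartbeats 400000 in
/-- **THE TARGET SIDE OF CLAUSE (1) OF `S34SomeSource` at `V`'s own §4.2 datum** (explicit carrier `C₄`, translates `T₄`, `τ′ := conj ∘ ι₁`).
Given the named facts `hMR` (III-8′ [MurtyRamakrishnan1992, Prop. 6] as invoked in [Liu2021] fn. 9; the registry's `stub_MR92Prop6Source` shape), `hU7`
([Milne2005ShimuraVarieties] Thm. 13.6), `h` ([Deligne1979ShimuraVarieties] 2.2.5), an étale Hecke datum `X` of `C₄` induced by `T₄`, a Betti pinning `B`
along `τ′` and a NON-ZERO `f` of the Hom-space: a conjugate level `Λ = bK″b⁻¹ ∩ K_f(3)`, the level class `y′ = Alb(T_b)^* Alb(T_1)^* y` (value of `f` at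
`ρ(b) w`), the E-pinned pieces `(g, X, ι, B_q)` of `(M_Λ)_{ι₁}` (★ (7c-rec) shape), a `2 + 1` FRAME `(J⋆, J⊥, B₀)` of `V.Hm` with `J⊥` totally positive, and
the class `c₁` on the piece through the IDENTITY class `q₁ = ⟦1⟧_Λ` (the displayed equation, along the bridge `E_Λ`), such that (i) every uniformised
special curve satisfying the four `F`-clauses at `(V.Hm, ι₁, Γ_V(g_{q₁} Λ g_{q₁}⁻¹), F ∙ B₀e₃)` DETECTS `c₁` (verbatim the `hdet` binder of ★ (7-src)
`exists_fac_pullback_ne_zero_of_rational_reps`), and (ii) EVERY morphism of towers into `C₄`'s tower with injective source étale transitions and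
injective source Albanese comparison whose level-`Λ` map detects `cmp_Λ y′` satisfies clause (1).  Proof: ★ spine with Hecke re-entry (comparisons
discharged, A-p02) → ★ 7a reps → ★ (L4) → §1c → bridge `E_{K″}` → §2a → ★ (7c-rec) at `Λ` → the identification
`E_Λ⁻¹{}^* cmp_Λ (Alb(T_b)^* y″) = (T_b^{rec})_{ι₁}^* E_{K″}⁻¹{}^* cmp_{K″} y″` (§1a, §1b, ★ `heckeTranslate_unique`) → frame ★
`exists_frame_formCongr_eq_finSum_of_isTotallyPositive_of_isHermitian`.  `hMR`, `hU7`, `h` are hypotheses; HC_CM is NOT proved.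
[cite: Liu2021, Thm. 4.15 proof (FJcycle.tex l. 2185–2213) with fn. 9; §4.2 l. 2062–2081; §4.3 l. 2152–2165; Lem. 2.4 (1)]
[cite: MurtyRamakrishnan1992, Prop. 6 (through Liu2021 fn. 9)] [cite: Milne2005ShimuraVarieties, Thm. 13.6 p. 118; §5 p. 58; Lemma 5.13 p. 57]
[cite: Deligne1979ShimuraVarieties, 2.1.2–2.1.4 and 2.2.5] [cite: GortzWedhorn2020, Prop. 4.16] [cite: Arapura2012, Cor. 15.4.6] [cite: SGA4Tome3, Exp. XI Thm. 4.4] -/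
theorem exists_identityPiece_detectingFrame_of_omegaHom_ne_zero
    (hMR : ∀ {X' : SchemeOver ℂ} (D' : UnitaryBallUniformisationDatum 2 X'), D'.MR92Prop6Source)
    (hU7 : heckeTranslate_definedOver) (h : exists_recordSystem) (V : HermSpace3 F ι₁)
    (Φ : Literature.AlgebraicGeometry.Motives.CMType F) (h4 : 4 ≤ Module.finrank ℚ F) (iso : ℕ → Prop)
    {ℓ : ℕ} [Fact ℓ.Prime] (X : (sec42DataOfFourLe h V Φ h4 iso).EtaleHeckeDatum ℓ) (ι' : ℂ ≃+* AlgebraicClosure ℚ_[ℓ])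
    (hX : X.IsInducedBy (sec42DataOfFourLe_heckeTranslates hU7 h V Φ h4 iso))
    {H : Type} [AddCommGroup H] [Module ℂ H] {rhoB : Representation ℂ (sec42DataOfFourLe h V Φ h4 iso).G H}
    (B : (sec42DataOfFourLe h V Φ h4 iso).BettiPinning (sec42DataOfFourLe_heckeTranslates hU7 h V Φ h4 iso)
      ((starRingEnd ℂ).comp ι₁) H rhoB)
    {W : Type} [AddCommGroup W] [Module ℂ W] (ρW : Representation ℂ (sec42DataOfFourLe h V Φ h4 iso).G W)
    (f : W →ₛₗ[(ι' : ℂ →+* AlgebraicClosure ℚ_[ℓ])] AlgebraicClosure ℚ_[ℓ] ⊗[ℚ_[ℓ]] (sec42DataOfFourLe h V Φ h4 iso).etaleH1Tower ℓ)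
    (hf : f ∈ X.omegaHom ι' ρW) (hf0 : f ≠ 0) :
    ∃ (Λ : C5.SmallLevel (sec42DataOfFourLe h V Φ h4 iso).S.K₀)
      (y' : (sec42DataOfFourLe h V Φ h4 iso).bettiH1 ((starRingEnd ℂ).comp ι₁) Λ)
      (g : orbitRel.Quotient (rational (↥(maximalRealSubfield F)) F (IsCMField.complexConj F) 3 V.Hm)
          (CosetSpace (rationalToFinAdelic (↥(maximalRealSubfield F)) F (IsCMField.complexConj F) 3 V.Hm) Λ.1.1) → ↥V.adelicFin)
      (_ : ∀ q, Quotient.mk'' (CosetSpace.pt (rationalToFinAdelic _ F _ 3 V.Hm) Λ.1.1 (g q)) = q)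
      (Xp : orbitRel.Quotient (rational (↥(maximalRealSubfield F)) F (IsCMField.complexConj F) 3 V.Hm)
          (CosetSpace (rationalToFinAdelic (↥(maximalRealSubfield F)) F (IsCMField.complexConj F) 3 V.Hm) Λ.1.1) → SchemeOver ℂ)
      (ι : ∀ q, Xp q ⟶ (baseChangeHom ι₁).obj ((recordOf h V h4).M.obj Λ))
      (_ : IsColimit (Cofan.mk ((baseChangeHom ι₁).obj ((recordOf h V h4).M.obj Λ)) ι))
      (Bq : ∀ q, UnitaryBallUniformisationDatum 2 (Xp q))
      (Jstar : Matrix (Fin 2) (Fin 2) F) (Jperp : Matrix (Fin 1) (Fin 1) F) (B₀ : GL (Fin 3) F)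
      (c₁ : complexBetti (Xp (Quotient.mk'' (CosetSpace.pt (rationalToFinAdelic _ F _ 3 V.Hm) Λ.1.1 1))) 1),
      (∀ q, (Bq q).E = ι₁.fieldRange ∧ (Bq q).Hℂ = V.Hm.map ι₁ ∧
        (Bq q).Γ.map (Matrix.GeneralLinearGroup.map ((Bq q).τ₁ : ↥(Bq q).E →+* ℂ)) =
          (arithmeticLevel (↥(maximalRealSubfield F)) F (IsCMField.complexConj F) 3 V.Hm
            (Λ.1.1.map (MulAut.conj (g q)).toMonoidHom)).map (Matrix.GeneralLinearGroup.map ι₁) ∧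
        letI : Algebra F ℂ := ι₁.toAlgebra
        ∀ x : Ball, AlgPoints.map (ι q) ((Bq q).unif ((Model.frameOf V : Matrix (Fin 3) (Fin 3) ℂ) *ᵥ BallModel.lift x)) =
          AlgPoints.baseChangeEquiv ι₁ ((Model.recordOf h V h4).M.obj Λ)
            (((Model.recordOf h V h4).pts Λ).symm
              (ShimuraSet.mk F V.Hm ι₁ (Model.frameOf V) (Model.formCongr_frameOf V) Λ.1.1 x (g q)))) ∧
      Literature.NumberTheory.Automorphic.formCongr (cmConjRingHom F) B₀ V.Hm = finSum 2 1 Jstar Jperp ∧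
      (∀ τ : F →+* ℂ, 0 < (τ (Jperp 0 0)).re) ∧
      c₁ = (complexBetti.map (ι (Quotient.mk'' (CosetSpace.pt (rationalToFinAdelic _ F _ 3 V.Hm) Λ.1.1 1))) 1).hom
        ((complexBetti.map
          (letI : Algebra F ℂ := Literature.NumberTheory.Automorphic.Liu2021.AppendixC.algebraAlong F ((starRingEnd ℂ).comp ι₁)
           (baseChangeHomObjIsoOfComp (cmConjRingHom F) ((starRingEnd ℂ).comp ι₁) ι₁ (conj_comp_comp_cmConjRingHom ι₁)
                ((recordFunctorOf h V).obj Λ) ≪≫ (baseChangeHom ι₁).mapIso (recordFunctorOf_objIso h V h4 Λ) :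
              (Literature.AlgebraicGeometry.Motives.baseChange F ℂ).obj ((sec42DataOfFourLe h V Φ h4 iso).X Λ) ≅
                (baseChangeHom ι₁).obj ((recordOf h V h4).M.obj Λ))).inv 1).hom
          (letI : Algebra F ℂ := Literature.NumberTheory.Automorphic.Liu2021.AppendixC.algebraAlong F ((starRingEnd ℂ).comp ι₁)
           albaneseH1Cmp ((sec42DataOfFourLe h V Φ h4 iso).X Λ) ((sec42DataOfFourLe h V Φ h4 iso).alb Λ) y')) ∧
      (∀ (Y' : SchemeOver ℂ) (D' : UnitaryBallUniformisationDatum 1 Y')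
          (φ' : Y' ⟶ Xp (Quotient.mk'' (CosetSpace.pt (rationalToFinAdelic _ F _ 3 V.Hm) Λ.1.1 1))) (M : Matrix (Fin 3) (Fin 2) ℂ),
        M.conjTranspose * V.Hm.map ι₁ * M = D'.Hℂ →
        (∀ v ∈ (F ∙ fun i => ((B₀ : GL (Fin 3) F) : Matrix (Fin 3) (Fin 3) F) i (Fin.last 2)), ∀ u : Fin 2 → ℂ,
          Literature.AlgebraicGeometry.ShimuraVarieties.hermForm (starRingEnd ℂ) (V.Hm.map ι₁) (⇑ι₁ ∘ v) (M.mulVec u) = 0) →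
        (∀ γ' ∈ D'.Γ, ∃ γ'' ∈ arithmeticLevel (↥(maximalRealSubfield F)) F (IsCMField.complexConj F) 3 V.Hm
            (Λ.1.1.map (MulAut.conj (g (Quotient.mk'' (CosetSpace.pt (rationalToFinAdelic _ F _ 3 V.Hm) Λ.1.1 1)))).toMonoidHom),
          (γ'' : Matrix (Fin 3) (Fin 3) F).map ι₁ * M = M * ((γ' : Matrix (Fin 2) (Fin 2) ↥D'.E)).map D'.E.subtype) →
        (∀ v ∈ negCone D'.Hℂ, AlgPoints.map (L := ℂ) φ' (D'.unif v) =
          (Bq (Quotient.mk'' (CosetSpace.pt (rationalToFinAdelic _ F _ 3 V.Hm) Λ.1.1 1))).unif (M.mulVec v)) →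
          singularCohomology.map ℂ ℂ (AlgPoints.mapContinuous (L := ℂ) φ') 1 c₁ ≠ 0) ∧
      (∀ {P5ₛ : PropC5Data (↥(maximalRealSubfield F)) F} {isoₛ : ℕ → Prop} {Cₛ : Sec42Data P5ₛ isoₛ} {Tₛ : Cₛ.HeckeTranslates}
          {φ : Cₛ.G →* (sec42DataOfFourLe h V Φ h4 iso).G} {hφ : Continuous φ}
          (M : Sec42Data.TowerHom Cₛ (sec42DataOfFourLe h V Φ h4 iso) Tₛ (sec42DataOfFourLe_heckeTranslates hU7 h V Φ h4 iso) φ hφ),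
        (∀ ⦃L L' : C5.SmallLevel Cₛ.S.K₀⦄ (u : L' ⟶ L), Injective (rationalTateModuleMap ℓ (Cₛ.Atr u)).dualMap) →
        (letI : Algebra F ℂ := Literature.NumberTheory.Automorphic.Liu2021.AppendixC.algebraAlong F ((starRingEnd ℂ).comp ι₁)
         Injective (albaneseH1Cmp (Cₛ.X (M.src Λ)) (Cₛ.alb (M.src Λ)))) →
        (letI : Algebra F ℂ := Literature.NumberTheory.Automorphic.Liu2021.AppendixC.algebraAlong F ((starRingEnd ℂ).comp ι₁)
         schemeBettiPullAlong ((starRingEnd ℂ).comp ι₁) (M.map Λ)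
            (albaneseH1Cmp ((sec42DataOfFourLe h V Φ h4 iso).X Λ) ((sec42DataOfFourLe h V Φ h4 iso).alb Λ) y') ≠ 0) →
          ((M.toEtaleTowerHom.etPull ℓ).baseChange (AlgebraicClosure ℚ_[ℓ])).comp f ≠ 0) := by
  letI inst : Algebra F ℂ := Literature.NumberTheory.Automorphic.Liu2021.AppendixC.algebraAlong F ((starRingEnd ℂ).comp ι₁)
  -- (0) the spine with Hecke re-entry, comparisons discharged (★ A-p02); `∃`-facts bound before `obtain` (edition 2, see §2a)
  have hspine := bettiPinning_exists_scheme_class_detecting_hecke_albaneseH1Cmp B ι' (h1ComparisonFamilyAlong ((starRingEnd ℂ).comp ι₁) ℓ ι')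
    hX hf hf0
  obtain ⟨w, K, y, -, -, hall⟩ := hspine
  -- (1) class representatives of `Ξ_K` (★ 7a) and the (L4) shrink `K″ ⊴ K`, `g_q K″ g_q⁻¹ ⊆ K_f(3)`
  have h7a := Summit.HodgeConjecture.CorCM.HComp.RecordSystem.exists_pieces_fieldRange _ V.Hm ι₁ (Model.frameOf V) (Model.formCongr_frameOf V) V.isHermitian
    (HermSpace3.anisotropic_of_four_le V h4) V.posDef_of_ne (torsionFree_arithmeticLevel_conj_K3 V) (Model.recordOf h V h4) K
  obtain ⟨gK, hgK, -⟩ := h7a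
  haveI : Finite (orbitRel.Quotient (rational (↥(maximalRealSubfield F)) F (IsCMField.complexConj F) 3 V.Hm) (CosetSpace (rationalToFinAdelic (↥(maximalRealSubfield F)) F
      (IsCMField.complexConj F) 3 V.Hm) K.1.1)) := UnitaryGroup.finite_shimuraIndex (hanis := HermSpace3.anisotropic_of_four_le V h4) (K := K.1.1) (hK := K.1.2.1)
  have hsmall := C5.exists_smallLevel_le_normalised_conj_le K gK
  obtain ⟨K'', hle, hnorm, hg0⟩ := hsmall
  have hallK := hall K'' (C5.HeckeLE.one_of_le hle)
  obtain ⟨hy'', -, hK''⟩ := hallK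
  -- (2) the re-levelled class `y″ := Alb(T_1)^* y` is non-zero on the variety `(X_{K″})_{τ′}` and, along the bridge, on `(M_{K″})_{ι₁}`
  have hx'' : albaneseH1Cmp ((sec42DataOfFourLe h V Φ h4 iso).X K'') ((sec42DataOfFourLe h V Φ h4 iso).alb K'')
      (bettiPullAlong ((starRingEnd ℂ).comp ι₁) ((sec42DataOfFourLe_heckeTranslates hU7 h V Φ h4 iso).albTr 1 K'' K (C5.HeckeLE.one_of_le hle)) y) ≠ 0 := fun h0 =>
    hy'' ((injective_albaneseH1Cmp_fourLe V Φ h4 iso h K'') (h0.trans (map_zero _).symm))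
  let EK : (Literature.AlgebraicGeometry.Motives.baseChange F ℂ).obj ((sec42DataOfFourLe h V Φ h4 iso).X K'') ≅ (baseChangeHom ι₁).obj ((recordOf h V h4).M.obj K'') :=
    baseChangeHomObjIsoOfComp (cmConjRingHom F) ((starRingEnd ℂ).comp ι₁) ι₁ (conj_comp_comp_cmConjRingHom ι₁) ((recordFunctorOf h V).obj K'') ≪≫
      (baseChangeHom ι₁).mapIso (recordFunctorOf_objIso h V h4 K'')
  have hxr : (complexBetti.map EK.inv 1).hom (albaneseH1Cmp ((sec42DataOfFourLe h V Φ h4 iso).X K'') ((sec42DataOfFourLe h V Φ h4 iso).alb K'')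
      (bettiPullAlong ((starRingEnd ℂ).comp ι₁) ((sec42DataOfFourLe_heckeTranslates hU7 h V Φ h4 iso).albTr 1 K'' K (C5.HeckeLE.one_of_le hle)) y)) ≠ 0 := fun h0 =>
    hx'' ((Literature.AlgebraicGeometry.Morphisms.complexBetti_map_iso_hom_injective EK.symm 1) (h0.trans (map_zero _).symm))
  -- (3) the record detour: `b`, the conjugate-level isomorphism `e : M_Λ ≅ M_{K″}`, identity-piece non-vanishing at `Λ`
  have h7d := exists_heckeTranslateIso_identityPiece_ne_zero_recordOf V h4 hU7 h hnorm gK hgK hg0 1 hxr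
  obtain ⟨b, hb, e, he, -, hId⟩ := h7d
  have hbΛ : C5.HeckeLE b (C5.heckeLevel b K'') K'' := C5.heckeLE_heckeLevel b K''
  -- (4) the E-pinned pieces of `(M_Λ)_{ι₁}` with their detecting lines (★ (7c-rec), III-8′ = `hMR`)
  have h7c := exists_pieces_detectingLine_recordOf h V h4 hMR (C5.heckeLevel b K'')
  obtain ⟨g, hg, Xp, ι, hcol, Bq, hBq⟩ := h7c
  have hId₁ := hId Bq hcol (Quotient.mk'' (CosetSpace.pt (rationalToFinAdelic _ F _ 3 V.Hm) (C5.heckeLevel b K'').1.1 1))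
    (hBq _).1.2.1 (g _) (hg _) (hBq _).1.2.2.2
  -- (5) the translated class `y′ := Alb(T_b)^* y″` at `Λ` and its identification along the bridges
  let EΛ : (Literature.AlgebraicGeometry.Motives.baseChange F ℂ).obj ((sec42DataOfFourLe h V Φ h4 iso).X (C5.heckeLevel b K'')) ≅
      (baseChangeHom ι₁).obj ((recordOf h V h4).M.obj (C5.heckeLevel b K'')) :=
    baseChangeHomObjIsoOfComp (cmConjRingHom F) ((starRingEnd ℂ).comp ι₁) ι₁ (conj_comp_comp_cmConjRingHom ι₁) ((recordFunctorOf h V).obj (C5.heckeLevel b K'')) ≪≫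
      (baseChangeHom ι₁).mapIso (recordFunctorOf_objIso h V h4 (C5.heckeLevel b K''))
  -- `T_b^{rec} = e.hom` (uniqueness of Hecke translates) and the bridge square for `T_b`
  have htr : recordHeckeTranslate hU7 h V h4 b (C5.heckeLevel b K'') K'' hbΛ = e.hom :=
    (recordOf h V h4).heckeTranslate_unique (isHeckeTranslate_recordHeckeTranslate hU7 h V h4 b _ K'' hbΛ) he
  -- Ed. 2: ★ §1b spells this square with `(baseChangeHom τ′).map ((baseChangeHom c).map _)` and un-ascribed bridge isos — definitionally this statement, but
  -- the KERNEL re-check of a direct `exact` normalises the two `Over`-composites (≈ 2.68 M heartbeats, 280 s); through `.left` it compares `Scheme` maps (≈ 30 k).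
  have hsq : (Literature.AlgebraicGeometry.Motives.baseChange F ℂ).map ((sec42DataOfFourLe_heckeTranslates hU7 h V Φ h4 iso).tr b (C5.heckeLevel b K'') K'' hbΛ) ≫
      EK.hom = EΛ.hom ≫ (baseChangeHom ι₁).map e.hom := by
    have hb' := baseChange_recordFunctorHeckeTranslate_comp_bridge_hom V h4 hU7 h b (C5.heckeLevel b K'') K'' hbΛ
    rw [htr] at hb'
    rw [sec42DataOfFourLe_heckeTranslates_tr]
    refine Over.OverMorphism.ext ?_
    have hb'' := congrArg CommaMorphism.left hb'
    simp only [Over.comp_left] at hb'' ⊢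
    exact hb''
  have hsq' : EΛ.inv ≫ (Literature.AlgebraicGeometry.Motives.baseChange F ℂ).map ((sec42DataOfFourLe_heckeTranslates hU7 h V Φ h4 iso).tr b (C5.heckeLevel b K'') K'' hbΛ) =
      (baseChangeHom ι₁).map e.hom ≫ EK.inv := by
    rw [Iso.inv_comp_eq, ← Category.assoc, Iso.eq_comp_inv, hsq]
  -- naturality of `cmp` along `Alb(T_b)` (★ §1a) and `hsq'` read through `H¹_B`, composed as TERMS (ed. 2: the former `rw` chain on this goal cost ≈ 290 k, this ≈ 30 k)
  have hnat := (sec42DataOfFourLe_heckeTranslates hU7 h V Φ h4 iso).albaneseH1Cmp_bettiPullAlong_albTr ((starRingEnd ℂ).comp ι₁) b (C5.heckeLevel b K'') K'' hbΛ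
    (bettiPullAlong ((starRingEnd ℂ).comp ι₁) ((sec42DataOfFourLe_heckeTranslates hU7 h V Φ h4 iso).albTr 1 K'' K (C5.HeckeLE.one_of_le hle)) y)
  have hB := (complexBetti.map_comp _ _ 1).symm.trans ((congrArg (complexBetti.map · 1) hsq').trans (complexBetti.map_comp _ _ 1))
  have key : (complexBetti.map EΛ.inv 1).hom (albaneseH1Cmp ((sec42DataOfFourLe h V Φ h4 iso).X (C5.heckeLevel b K'')) ((sec42DataOfFourLe h V Φ h4 iso).alb _)
        (bettiPullAlong ((starRingEnd ℂ).comp ι₁) ((sec42DataOfFourLe_heckeTranslates hU7 h V Φ h4 iso).albTr b (C5.heckeLevel b K'') K'' hbΛ)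
          (bettiPullAlong ((starRingEnd ℂ).comp ι₁) ((sec42DataOfFourLe_heckeTranslates hU7 h V Φ h4 iso).albTr 1 K'' K (C5.HeckeLE.one_of_le hle)) y))) =
      (complexBetti.map ((baseChangeHom ι₁).map e.hom) 1).hom ((complexBetti.map EK.inv 1).hom
        (albaneseH1Cmp ((sec42DataOfFourLe h V Φ h4 iso).X K'') ((sec42DataOfFourLe h V Φ h4 iso).alb K'')
          (bettiPullAlong ((starRingEnd ℂ).comp ι₁) ((sec42DataOfFourLe_heckeTranslates hU7 h V Φ h4 iso).albTr 1 K'' K (C5.HeckeLE.one_of_le hle)) y))) :=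
    (congrArg (fun t => (complexBetti.map EΛ.inv 1).hom t) hnat).trans (congrArg (fun φ => (ModuleCat.Hom.hom φ) _) hB)
  have hc₁ : (complexBetti.map (ι (Quotient.mk'' (CosetSpace.pt (rationalToFinAdelic _ F _ 3 V.Hm) (C5.heckeLevel b K'').1.1 1))) 1).hom ((complexBetti.map EΛ.inv 1).hom
        (albaneseH1Cmp ((sec42DataOfFourLe h V Φ h4 iso).X (C5.heckeLevel b K'')) ((sec42DataOfFourLe h V Φ h4 iso).alb _)
          (bettiPullAlong ((starRingEnd ℂ).comp ι₁) ((sec42DataOfFourLe_heckeTranslates hU7 h V Φ h4 iso).albTr b (C5.heckeLevel b K'') K'' hbΛ)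
            (bettiPullAlong ((starRingEnd ℂ).comp ι₁) ((sec42DataOfFourLe_heckeTranslates hU7 h V Φ h4 iso).albTr 1 K'' K (C5.HeckeLE.one_of_le hle)) y)))) ≠ 0 :=
    ne_of_eq_of_ne (congrArg (fun t => (complexBetti.map (ι _) 1).hom t) key) hId₁
  -- (6) the detecting `F`-line of the class on the identity piece, and its frame
  have hline := (hBq (Quotient.mk'' (CosetSpace.pt (rationalToFinAdelic _ F _ 3 V.Hm) (C5.heckeLevel b K'').1.1 1))).2 _ hc₁
  obtain ⟨W₀, hW₀, h1, hdetW⟩ := hline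
  have hσ : ∀ x : F, cmConjRingHom F (cmConjRingHom F x) = x := fun x => by
    rw [cmConjRingHom_apply, cmConjRingHom_apply]
    exact IsCMField.complexConj_apply_apply F x
  have hframe := Literature.AlgebraicGeometry.ShimuraVarieties.exists_frame_formCongr_eq_finSum_of_isTotallyPositive_of_isHermitian
    (cmConjRingHom F) V.Hm hσ V.isHermitian W₀ hW₀ h1
  obtain ⟨Jstar, Jperp, B₀, hB₀, hpos, hspan, -, -⟩ := hframe
  refine ⟨C5.heckeLevel b K'', bettiPullAlong ((starRingEnd ℂ).comp ι₁) ((sec42DataOfFourLe_heckeTranslates hU7 h V Φ h4 iso).albTr b (C5.heckeLevel b K'') K'' hbΛ)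
      (bettiPullAlong ((starRingEnd ℂ).comp ι₁) ((sec42DataOfFourLe_heckeTranslates hU7 h V Φ h4 iso).albTr 1 K'' K (C5.HeckeLE.one_of_le hle)) y),
    g, hg, Xp, ι, hcol, Bq, Jstar, Jperp, B₀, _, fun q => (hBq q).1, hB₀, hpos, rfl, ?_, ?_⟩
  · -- (i) III-8′, framed: the line `F ∙ B₀ e₃` IS `W₀`
    intro Y' D' φ' M hgram horth hgroup hunif
    refine hdetW Y' D' φ' M hgram (fun v hv u => horth v ?_ u) hgroup hunif
    rw [hspan]
    exact hv
  · -- (ii) clause (1) for every detecting morphism of towers, at the vector `ρ(b) w` (★ spine §6)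
    intro P5ₛ isoₛ Cₛ Tₛ φ hφ M hIₛ hinjS hdet
    exact (hK'' b (C5.heckeLevel b K'') hbΛ).2 M hIₛ hinjS hdet

end Main
end Summit.HodgeConjecture.CorCM.Model

end
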